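/-
Copyright (c) 2026 the pub-hodgecm-mathlib formalisation cell (harness21).  Prover seat hodgecm-mathlib-F0P2-p11 (g3): Track B «K2-LIT»,
hLiu418 = stmt-HodgeConjecture-24832; LEAD F0P6-plan (g14∕g15) BATCH #155 (1) «(K1a-3) ∕ D-2», line lead K2E5-p16 (g8); default brick 2026-09-05T00:48Z:
the H-side half of D-2's `hΛ` — the ball value is a `(N_corner, ψ_σ)`-quasi-invariant functional of the translate.
-/
import Summits.HodgeConjecture.HodgeConjecture.Theorems.K2LiuRankOneStageTwistedBall     -- ★ p863296 (this seat): the ball currency (+ ★ `K2LiuRankOneStageTwisted` §1 letters)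
import HarnessLib

/-!
# Crux `HLiu418`, road `K2_Liu`, KIND 1 a♮ ∕ #42S BLOCK D — `K2LiuRankOneStageBallEquivariance`: A BALL VALUE `Gn(h) = c·∫_{𝔭^{−k}} conj ψ(σx)·N(w₀ u(x) h) dμ` (all large `k`)
# IS `(u, ψ_σ)`-QUASI-INVARIANT IN THE TRANSLATE: `Gn(u(t)·h) = ψ(σt)·Gn(h)` — the regularised Whittaker functional keeps its equivariance at EVERY `s₀`

Cell `hodgecm-mathlib`, crux item hLiu418 = `stmt-HodgeConjecture-24832`; squad K2 ∕ K2Liu; prover F0P2-p11 (g3).  THEOREMS ONLY (no `def`, no instance, no notation, no named-fact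
hypothesis, no `sorry`, DEFAULT heartbeats); lane `--supports stmt-HodgeConjecture-24832 --as helper` (count-neutral helper).  Abstract: a non-archimedean local field `F` with an additive
Haar measure `μ`, an additive character `ψ`, a scalar `σ`, a group `G`, an additive one-parameter map `u : F → G`, an element `w₀`.

THE POINT.  Every head of this seat's (K1a-3) chain (★ p863296 (iii), ★ p863537 ∕ p863539 (f), ★ p863595 (f′), ★ p863771 `hball`) presents the continued bad-place factor as a
BALL VALUE: `Gn s₀ h = c(s₀) · ∫_{x ∈ 𝔭^{−k}} conj ψ(σx) · N s₀ (w₀ · u(x) · h) dμ(x)` for all `k ≥ k₀(h)` — also at `s₀ = ½`, where the defining Whittaker-type integral over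
`N_Δ(F_v)` diverges.  The new road of record for D-2 (K2Liu-p12 (g5) ★ p863653 ∕ p863715 `hbad_faces_of_lineFunctional`) needs the bad factor to be a QUASI-INVARIANT
functional (`hΛ`); THIS FILE proves the `H_v`-side half of that letter from the ball shape alone: translating `h` by the corner unipotent `u(t)` multiplies the ball value by
`ψ(σt)` — because `u(x)·u(t) = u(x+t)`, a ball `𝔭^{−k} ∋ t` is invariant under `x ↦ x + t` (Haar), and `conj ψ(σx) = ψ(σt)·conj ψ(σ(x+t))`.  No convergence, no continuation, no
frame: the regularised rank-one Whittaker functional keeps its `(N_corner, ψ_σ)`-equivariance at EVERY `s₀`.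
* §1 (local field) `setIntegral_primePowBall_comp_add` (`∫_{x ∈ 𝔭^n} g(x+t) dμ = ∫_{x ∈ 𝔭^n} g dμ` for `t ∈ 𝔭^n`, any `g`, no integrability — Haar + the indicator trick of
  ★ F1 `setIntegral_eq_zero_of_translate`), **`setIntegral_primePowBall_conj_addChar_mul_comp_add`** (`∫_{𝔭^n} conj ψ(σx)·F(x+t) dμ = ψ(σt)·∫_{𝔭^n} conj ψ(σx)·F x dμ`),
  `exists_nat_mem_primePowBall_neg` (every `t` lies in some `𝔭^{−k}`, `k : ℕ`).
* §2 (any group `G`) **`apply_mul_eq_addChar_mul_of_ball`** — if `∀ h, ∃ k₀, ∀ k ≥ k₀, Gn h = c·∫_{x ∈ 𝔭^{−k}} conj ψ(σx)·N(w₀·u(x)·h) dμ` and `u(x+t) = u(x)·u(t)`, then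
  **`Gn (u(t)·h) = ψ(σt)·Gn h`** for all `t, h`; and `apply_mul_eq_of_addChar_eq_one` (`ψ(σt) = 1 ⇒` invariance), `apply_eq_zero_of_addChar_ne_one_of_mul_eq`
  (`u(t)·h` and `h` give the same value while `ψ(σt) ≠ 1 ⇒ Gn h = 0` — the lattice-support mechanism of ★ (c4)∕★ `K2LiuRankOneStageTwistedSupport` in one line).
CONSUMERS instantiate per `s₀`: `G := H_v`, `u := x ↦ φ(u_{2e₂}(ι x δ))` (★ `frameConj_uLongTwo_coord_add`), `w₀ := φ(w₂)`, `N := N₂ s₀`, `c := cW s₀`, `Gn := Gn s₀` — ★ p863537 ∕ p863539 (f)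
at every `s₀`, ★ p863595 ∕ ★ p863771 on `0 < re s₀` (there `ψ = ψ_{L⁺,v}`, `σ = −τ_v`).
HONEST LABEL.  `HC_CM` is proved only modulo the 7 printed citations (2 remaining named inputs: hLiu418 = `stmt-HodgeConjecture-24832`,
h413 = `stmt-HodgeConjecture-24833`) until rung 0 closes; this file is a count-neutral helper and closes no socket.

## References
* [CasselmanShalika1980] W. Casselman, J. Shalika, Compositio Math. 41 (1980), §2 (Whittaker functionals along the last rank-one step; compact truncations).
* [KudlaRallis1994] S. Kudla, S. Rallis, Ann. of Math. 140 (1994), §2–§3 (quasi-invariant functionals and singular coefficients).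
* [Tate1950] J. Tate, *Fourier analysis in number fields and Hecke's zeta-functions* (1950), §2.2 (Haar measure and the balls `𝔭^n`).
-/

set_option autoImplicit false
set_option linter.dupNamespace false -- the mandated namespace repeats `HodgeConjecture.HodgeConjecture`

noncomputable section

open MeasureTheory Filter Topology Set
open scoped NNReal ENNReal ComplexConjugate
open NumberField IsDedekindDomain
open Literature.NumberTheory.GaloisRepresentations.IsNonarchimedeanLocalField
open Literature.NumberTheory.Automorphic Literature.NumberTheory.Automorphic.LocalFieldHaar
open Summit.HodgeConjecture.HodgeConjecture.Cruxes.HLiu418.K2LiuRankOneStageTwisted (add_mem_primePowBall_iff_of_mem)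

namespace Summit.HodgeConjecture.HodgeConjecture.Cruxes.HLiu418.K2LiuRankOneStageBallEquivariance

/-! ## §1 Translating a ball integral; the character factor -/

section LocalField

variable {F : Type*} [Field F] [ValuativeRel F] [TopologicalSpace F] [IsNonarchimedeanLocalField F]
variable [MeasurableSpace F] [BorelSpace F] (μ : Measure F) [μ.IsAddHaarMeasure]

/-- **A BALL INTEGRAL IS INVARIANT UNDER TRANSLATION BY AN ELEMENT OF THE BALL**: `∫_{x ∈ 𝔭^n} g(x + t) dμ = ∫_{x ∈ 𝔭^n} g dμ` for `t ∈ 𝔭^n` — for EVERY `g` (no integrability: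
both sides are junk together), by Haar invariance of `μ` and `x + t ∈ 𝔭^n ↔ x ∈ 𝔭^n` (the indicator trick of ★ F1 `setIntegral_eq_zero_of_translate`). [cite: Tate1950, §2.2] -/
theorem setIntegral_primePowBall_comp_add (n : ℤ) {t : F} (ht : t ∈ primePowBall F n) (g : F → ℂ) :
    ∫ x in primePowBall F n, g (x + t) ∂μ = ∫ x in primePowBall F n, g x ∂μ := by
  rw [← integral_indicator (measurableSet_primePowBall n), ← integral_indicator (measurableSet_primePowBall n)]
  have hfun : (primePowBall F n).indicator (fun x => g (x + t)) = fun x => (primePowBall F n).indicator g (x + t) := by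
    funext x
    by_cases hx : x ∈ primePowBall F n
    · rw [indicator_of_mem hx, indicator_of_mem ((add_mem_primePowBall_iff_of_mem ht x).2 hx)]
    · rw [indicator_of_notMem hx, indicator_of_notMem (fun h => hx ((add_mem_primePowBall_iff_of_mem ht x).1 h))]
  rw [hfun, integral_add_right_eq_self _ t]

/-- **THE CHARACTER FACTOR**: `∫_{x ∈ 𝔭^n} conj ψ(σx)·F(x + t) dμ = ψ(σt) · ∫_{x ∈ 𝔭^n} conj ψ(σx)·F x dμ` for `t ∈ 𝔭^n` (translate by `t`; `conj ψ(σx) = ψ(σt)·conj ψ(σ(x+t))` since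
`|ψ| = 1`). [cite: Tate1950, §2.2] [cite: CasselmanShalika1980, §2] -/
theorem setIntegral_primePowBall_conj_addChar_mul_comp_add (ψ : AddChar F Circle) (σ : F) (n : ℤ) {t : F} (ht : t ∈ primePowBall F n) (Fx : F → ℂ) :
    ∫ x in primePowBall F n, conj ((ψ (σ * x) : ℂ)) * Fx (x + t) ∂μ = ((ψ (σ * t) : Circle) : ℂ) * ∫ x in primePowBall F n, conj ((ψ (σ * x) : ℂ)) * Fx x ∂μ := by
  have hkey : ∀ x : F, conj ((ψ (σ * x) : ℂ)) * Fx (x + t) = ((ψ (σ * t) : Circle) : ℂ) * (conj ((ψ (σ * (x + t)) : ℂ)) * Fx (x + t)) := by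
    intro x
    have h1 : conj ((ψ (σ * t) : Circle) : ℂ) * ((ψ (σ * t) : Circle) : ℂ) = 1 := by
      rw [← Circle.coe_inv_eq_conj, ← Circle.coe_mul, inv_mul_cancel, Circle.coe_one]
    have e1 : ((ψ (σ * (x + t)) : Circle) : ℂ) = ((ψ (σ * x) : Circle) : ℂ) * ((ψ (σ * t) : Circle) : ℂ) := by
      rw [mul_add, AddChar.map_add_eq_mul, Circle.coe_mul]
    rw [e1, map_mul (starRingEnd ℂ) (((ψ (σ * x) : Circle) : ℂ)) (((ψ (σ * t) : Circle) : ℂ))]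
    linear_combination (-(conj ((ψ (σ * x) : Circle) : ℂ) * Fx (x + t))) * h1
  simp_rw [hkey]
  rw [integral_const_mul, setIntegral_primePowBall_comp_add μ n ht (fun x => conj ((ψ (σ * x) : ℂ)) * Fx x)]

omit [MeasurableSpace F] [BorelSpace F] in
/-- every `t` lies in some ball `𝔭^{−k}`, `k : ℕ` (`‖t‖ = q^{−j}` ⇒ `k := (−j)⁺`). [cite: Tate1950, §2.2] -/
theorem exists_nat_mem_primePowBall_neg (t : F) : ∃ k : ℕ, t ∈ primePowBall F (-(k : ℤ)) := by
  by_cases ht : t = 0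
  · exact ⟨0, by rw [ht]; exact zero_mem_primePowBall _⟩
  obtain ⟨j, hj⟩ := exists_normAbs_eq_inv_zpow ht
  refine ⟨(-j).toNat, ?_⟩
  rw [mem_primePowBall_iff, hj]
  exact zpow_le_zpow_right_of_le_one₀ inv_residueFieldCard_pos inv_residueFieldCard_lt_one.le (by omega)

end LocalField

/-! ## §2 A ball value is `(u, ψ_σ)`-quasi-invariant in the translate -/

section Ball

variable {F : Type*} [Field F] [ValuativeRel F] [TopologicalSpace F] [IsNonarchimedeanLocalField F]
variable [MeasurableSpace F] [BorelSpace F] (μ : Measure F) [μ.IsAddHaarMeasure] {G : Type*} [Group G]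

/-- **THE REGULARISED WHITTAKER FUNCTIONAL KEEPS ITS EQUIVARIANCE.**  Let `u : F → G` be additive-to-multiplicative (`u(x + t) = u(x)·u(t)`), `w₀ ∈ G`, `N, Gn : G → ℂ`, `c : ℂ`, and
suppose the BALL CLAUSE `∀ h, ∃ k₀, ∀ k ≥ k₀, Gn h = c · ∫_{x ∈ 𝔭^{−k}} conj ψ(σx) · N(w₀ · u(x) · h) dμ(x)` (the shape of ★ p863296 (iii) ∕ ★ p863537–p863771 at a fixed `s₀`).
Then **`Gn (u(t) · h) = ψ(σt) · Gn h`** for all `t ∈ F`, `h ∈ G`: take `k` past both thresholds with `t ∈ 𝔭^{−k}`; `N(w₀ u(x) u(t) h) = N(w₀ u(x+t) h)` and §1.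
[cite: CasselmanShalika1980, §2] [cite: KudlaRallis1994, §2–§3] -/
theorem apply_mul_eq_addChar_mul_of_ball {u : F → G} (hu_add : ∀ x t, u (x + t) = u x * u t) (w₀ : G) (ψ : AddChar F Circle) (σ : F)
    (N Gn : G → ℂ) (c : ℂ)
    (hball : ∀ h : G, ∃ k₀ : ℕ, ∀ k : ℕ, k₀ ≤ k → Gn h = c * ∫ x in primePowBall F (-(k : ℤ)), conj ((ψ (σ * x) : ℂ)) * N (w₀ * u x * h) ∂μ)
    (t : F) (h : G) : Gn (u t * h) = ((ψ (σ * t) : Circle) : ℂ) * Gn h := by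
  obtain ⟨k₁, hk₁⟩ := hball h
  obtain ⟨k₂, hk₂⟩ := hball (u t * h)
  obtain ⟨k₃, hk₃⟩ := exists_nat_mem_primePowBall_neg t
  set k : ℕ := max k₁ (max k₂ k₃) with hk
  have ht : t ∈ primePowBall F (-(k : ℤ)) := primePowBall_antitone (by simp [hk]) hk₃
  have hword : ∀ x : F, N (w₀ * u x * (u t * h)) = N (w₀ * u (x + t) * h) := fun x => by rw [hu_add, ← mul_assoc, mul_assoc w₀]
  rw [hk₂ k (by simp [hk]), hk₁ k (by simp [hk])]
  simp_rw [hword]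
  rw [setIntegral_primePowBall_conj_addChar_mul_comp_add μ ψ σ (-(k : ℤ)) ht (fun x => N (w₀ * u x * h)), mul_left_comm]

/-- **Invariance where the character is trivial**: `ψ(σt) = 1 ⇒ Gn (u(t)·h) = Gn h`. [cite: CasselmanShalika1980, §2] -/
theorem apply_mul_eq_of_addChar_eq_one {u : F → G} (hu_add : ∀ x t, u (x + t) = u x * u t) (w₀ : G) (ψ : AddChar F Circle) (σ : F)
    (N Gn : G → ℂ) (c : ℂ)
    (hball : ∀ h : G, ∃ k₀ : ℕ, ∀ k : ℕ, k₀ ≤ k → Gn h = c * ∫ x in primePowBall F (-(k : ℤ)), conj ((ψ (σ * x) : ℂ)) * N (w₀ * u x * h) ∂μ)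
    {t : F} (ht : ψ (σ * t) = 1) (h : G) : Gn (u t * h) = Gn h := by
  rw [apply_mul_eq_addChar_mul_of_ball μ hu_add w₀ ψ σ N Gn c hball t h, ht, Circle.coe_one, one_mul]

/-- **THE LATTICE-SUPPORT MECHANISM IN ONE LINE**: if translating by `u(t)` does not change the value (`Gn (u(t)·h) = Gn h`, e.g. `h⁻¹ u(t) h` in the right level of the section)
while `ψ(σt) ≠ 1`, then `Gn h = 0` — the regularised functional dies off the dual lattice of its level (cf. ★ `K2LiuRankOneStageTwistedSupport`, ★ (c4)).
[cite: CasselmanShalika1980, §2] [cite: KudlaRallis1994, §2–§3] -/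
theorem apply_eq_zero_of_addChar_ne_one_of_mul_eq {u : F → G} (hu_add : ∀ x t, u (x + t) = u x * u t) (w₀ : G) (ψ : AddChar F Circle) (σ : F)
    (N Gn : G → ℂ) (c : ℂ)
    (hball : ∀ h : G, ∃ k₀ : ℕ, ∀ k : ℕ, k₀ ≤ k → Gn h = c * ∫ x in primePowBall F (-(k : ℤ)), conj ((ψ (σ * x) : ℂ)) * N (w₀ * u x * h) ∂μ)
    {t : F} (hψt : ψ (σ * t) ≠ 1) {h : G} (hinv : Gn (u t * h) = Gn h) : Gn h = 0 := by
  have hζ : ((ψ (σ * t) : Circle) : ℂ) ≠ 1 := fun h1 => hψt (Circle.coe_eq_one.1 h1)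
  have key : (((ψ (σ * t) : Circle) : ℂ) - 1) * Gn h = 0 := by
    rw [sub_mul, one_mul, ← apply_mul_eq_addChar_mul_of_ball μ hu_add w₀ ψ σ N Gn c hball t h, hinv, sub_self]
  exact (mul_eq_zero.1 key).resolve_left (sub_ne_zero.2 hζ)

end Ball

end Summit.HodgeConjecture.HodgeConjecture.Cruxes.HLiu418.K2LiuRankOneStageBallEquivariance

end
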